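import Summits.AtomisticToContinuum.HydrodynamicLimit.Theorems.OneFlightGossipEngineEnergyCurrentTailsGainCeilingGlue
import Summits.AtomisticToContinuum.HydrodynamicLimit.Theorems.OneFlightGossipEngineEnergyCurrentTailsQuarticLedger
import Summits.AtomisticToContinuum.HydrodynamicLimit.Theorems.OneFlightGossipEngineEnergyCurrentTailsQuarticData
import Summits.AtomisticToContinuum.HydrodynamicLimit.Theorems.OneFlightGossipEngineEnergyCurrentTailsWindowQuarticFloor
import HarnessLib

/-!
# The window loss floor S1 from the loss-intensity floor (stub S1-glue, line `quartic-schur-ledger`,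
# crux `EnergyCurrentTails`, stmt-AtomisticToContinuum-9235)

Registered stub `stub_lossFloor_of_lossIntensityFloor` of the lead's skeleton
`Cruxes/EnergyCurrentTails/Lines/quartic_schur_ledger.lean`: `S2 → LIF → S1` (Q0 `stub_quarticData` and
WF `stub_windowQuarticFloor` are LANDED and used by name).  With
`y = m₄`, `Loss(s,s′]` the expected normalised collision sum of `(Δ₄)₋/2`, `M₅^{>K₀}` the fifth moment
above speed `K₀`, `ν_N = σ²(N+1)^{1/3}`: assuming the gain ceiling S2, the datum bound Q0, the
loss-intensity floor LIF (`δν_N∫M₅^{>K₀} ≤ Loss + Cν_N(s′−s) sup m₂ sup m₃`) and the window floor WF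
(`(s′−s)K₀y(s) ≤ ∫M₅^{>K₀} + (s′−s)K₀⁵ + (s′−s)K₀Loss`), S1 follows: `c y(s) ≤ cA + Loss(s,s+(N+1)^{-1/3}]`.
Proof: window `h = (N+1)^{-1/3}` (`τ = 1`, `ν_N h = σ²`), horizon `t + 2` in LIF; WF × `δν_N` and LIF
give `κ₀y(s) ≤ (1+κ₀)Loss + κ₀K₀⁴ + Cσ² sup m₂ sup m₃` (`κ₀ = δσ²K₀`, `lossFloorGlue_core`);
`m₂ ≤ 1+B` (`lintegral_normSqAvg_le`), `m₃ ≤ (l/2)y + m₂/(2l)` (`lintegral_cubicAvg_le`),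
`Y = sup y ≤ y(s) + D + Y/2` (ledger L + S2 on sub-windows, `Y < ∞` by Q0); absorbing with
`Cσ²(1+B)l ≤ κ₀/4` leaves `(κ₀/2)y(s) ≤ (1+κ₀)Loss + R`, i.e. S1 with `c = (κ₀/2)/(1+κ₀)`,
`A = R/(κ₀/2)` (`lossFloorGlue_real/_ennreal/_window`).
References: Bobylev 1997; Mischler–Wennberg 1999; Mischler–Mouhot 2013.
-/

noncomputable section
open MeasureTheory Set Filter
open scoped ENNReal
namespace Summit.AtomisticToContinuum.HydrodynamicLimit.Theorems.QuarticSchurLedger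
open Literature.MathematicalPhysics.KineticTheory Literature.Analysis.FluidPDE
/-- **The absorption step in `ℝ`.**  From `κ y ≤ L + p S₂ S₃ + κ q + κ L`, `S₂ ≤ M`,
`S₃ ≤ (l/2) Y + M/(2l)`, `Y ≤ y + D + η Y` with `η ≤ 1/2` and `p M l ≤ κ/4`:
`(κ/2) y ≤ (κ q + (κ/4) D + p M · M/(2l)) + (1+κ) L`. [folklore] -/
theorem lossFloorGlue_real {y L S2 S3 Y κ q p M l D η : ℝ}
    (hy : 0 ≤ y) (hS3 : 0 ≤ S3) (hY : 0 ≤ Y) (hκ : 0 ≤ κ) (hp : 0 ≤ p) (hM : 0 ≤ M)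
    (hη : η ≤ 1 / 2) (hpl : p * M * l ≤ κ / 4)
    (h1 : κ * y ≤ L + p * S2 * S3 + κ * q + κ * L) (h2 : S2 ≤ M)
    (h3 : S3 ≤ l / 2 * Y + 1 / (2 * l) * M) (h4 : Y ≤ y + D + η * Y) :
    κ / 2 * y ≤ (κ * q + κ / 4 * D + p * M * (1 / (2 * l) * M)) + (1 + κ) * L := by
  have hY2 : Y ≤ 2 * (y + D) := by
    have : η * Y ≤ 1 / 2 * Y := mul_le_mul_of_nonneg_right hη hY
    linarith
  have hA : p * S2 * S3 ≤ p * M * S3 :=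
    mul_le_mul_of_nonneg_right (mul_le_mul_of_nonneg_left h2 hp) hS3
  have hB : p * M * S3 ≤ p * M * (l / 2 * Y + 1 / (2 * l) * M) :=
    mul_le_mul_of_nonneg_left h3 (mul_nonneg hp hM)
  have hC : p * M * (l / 2 * Y) ≤ κ / 4 * (y + D) := by
    calc p * M * (l / 2 * Y) = p * M * l * (Y / 2) := by ring
      _ ≤ κ / 4 * (Y / 2) := mul_le_mul_of_nonneg_right hpl (by positivity)
      _ ≤ κ / 4 * (y + D) := mul_le_mul_of_nonneg_left (by linarith) (by positivity)
  have hκy : 0 ≤ κ * y := mul_nonneg hκ hy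
  linarith
/-- **The final division in `ℝ`.**  `(κ/2) y ≤ R + (1+κ) L` gives `c y ≤ c (R/(κ/2)) + L` with
`c = (κ/2)/(1+κ)`. [folklore] -/
theorem lossFloorGlue_div {y L R κ : ℝ} (hκ : 0 < κ) (h : κ / 2 * y ≤ R + (1 + κ) * L) :
    κ / 2 / (1 + κ) * y ≤ κ / 2 / (1 + κ) * (R / (κ / 2)) + L := by
  have h1κ : 0 < 1 + κ := by linarith
  have hκ2 : κ / 2 ≠ 0 := by positivity
  calc κ / 2 / (1 + κ) * y = (κ / 2 * y) / (1 + κ) := by ring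
    _ ≤ (R + (1 + κ) * L) / (1 + κ) := div_le_div_of_nonneg_right h h1κ.le
    _ = κ / 2 / (1 + κ) * (R / (κ / 2)) + L := by
        field_simp
/-- **The clock cancels: WF × `δν` and LIF.**  If `a·ys ≤ I + b + a·Lo` and `k·I ≤ Lo + p S₂ S₃`
with `k a = κ`, `k b = κ q`, then `κ ys ≤ Lo + p S₂ S₃ + κ q + κ Lo` (all in `ℝ≥0∞`, real `ofReal`
coefficients). [folklore] -/
theorem lossFloorGlue_core {ys Lo I S₂ S₃ : ℝ≥0∞} {a b k p κ q : ℝ} (hk : 0 ≤ k)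
    (hka : k * a = κ) (hkb : k * b = κ * q)
    (hWF : ENNReal.ofReal a * ys ≤ I + ENNReal.ofReal b + ENNReal.ofReal a * Lo)
    (hLIF : ENNReal.ofReal k * I ≤ Lo + ENNReal.ofReal p * S₂ * S₃) :
    ENNReal.ofReal κ * ys ≤
      Lo + ENNReal.ofReal p * S₂ * S₃ + ENNReal.ofReal (κ * q) + ENNReal.ofReal κ * Lo := by
  calc ENNReal.ofReal κ * ys = ENNReal.ofReal k * (ENNReal.ofReal a * ys) := by
        rw [← mul_assoc, ← ENNReal.ofReal_mul hk, hka]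
    _ ≤ ENNReal.ofReal k * (I + ENNReal.ofReal b + ENNReal.ofReal a * Lo) := mul_le_mul' le_rfl hWF
    _ = ENNReal.ofReal k * I + ENNReal.ofReal (κ * q) + ENNReal.ofReal κ * Lo := by
        rw [mul_add, mul_add, ← ENNReal.ofReal_mul hk, hkb, ← mul_assoc, ← ENNReal.ofReal_mul hk,
          hka]
    _ ≤ Lo + ENNReal.ofReal p * S₂ * S₃ + ENNReal.ofReal (κ * q) + ENNReal.ofReal κ * Lo :=
        add_le_add (add_le_add hLIF le_rfl) le_rfl
/-- **The absorption step in `ℝ≥0∞`.**  With `ys, Y` finite (and `Lo` either infinite — trivial — or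
finite), the four window inequalities pass to `ℝ` (`lossFloorGlue_real`) and back:
`c · ys ≤ c · A + Lo` with `c = (κ/2)/(1+κ)`, `A = (κ q + (κ/4) D + p M · M/(2l))/(κ/2)`. [folklore] -/
theorem lossFloorGlue_ennreal {ys Lo I S₂ S₃ Y : ℝ≥0∞} {a b k p κ q M l D η : ℝ}
    (hk : 0 ≤ k) (hp : 0 ≤ p) (hκ : 0 < κ) (hq : 0 ≤ q) (hM : 0 ≤ M)
    (hl : 0 < l) (hD : 0 ≤ D) (hη0 : 0 ≤ η) (hη : η ≤ 1 / 2) (hpl : p * M * l ≤ κ / 4)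
    (hka : k * a = κ) (hkb : k * b = κ * q) (hys : ys ≠ ⊤) (hY : Y ≠ ⊤)
    (hWF : ENNReal.ofReal a * ys ≤ I + ENNReal.ofReal b + ENNReal.ofReal a * Lo)
    (hLIF : ENNReal.ofReal k * I ≤ Lo + ENNReal.ofReal p * S₂ * S₃)
    (hS₂ : S₂ ≤ ENNReal.ofReal M)
    (hS₃ : S₃ ≤ ENNReal.ofReal (l / 2) * Y + ENNReal.ofReal (1 / (2 * l)) * ENNReal.ofReal M)
    (hYb : Y ≤ ys + ENNReal.ofReal D + ENNReal.ofReal η * Y) :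
    ENNReal.ofReal (κ / 2 / (1 + κ)) * ys ≤
      ENNReal.ofReal (κ / 2 / (1 + κ) *
          ((κ * q + κ / 4 * D + p * M * (1 / (2 * l) * M)) / (κ / 2))) + Lo := by
  have hstar := lossFloorGlue_core hk hka hkb hWF hLIF
  clear hWF hLIF
  rcases eq_or_ne Lo ⊤ with hLo | hLo
  · rw [hLo, add_top]
    exact le_top
  -- finiteness of the four finite quantities, and their real forms
  have hS₂f : S₂ ≠ ⊤ := ne_top_of_le_ne_top ENNReal.ofReal_ne_top hS₂
  have hS₃f : S₃ ≠ ⊤ :=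
    ne_top_of_le_ne_top (ENNReal.add_ne_top.2 ⟨ENNReal.mul_ne_top ENNReal.ofReal_ne_top hY,
      ENNReal.mul_ne_top ENNReal.ofReal_ne_top ENNReal.ofReal_ne_top⟩) hS₃
  obtain ⟨y, hy0, rfl⟩ : ∃ r : ℝ, 0 ≤ r ∧ ys = ENNReal.ofReal r :=
    ⟨_, ENNReal.toReal_nonneg, (ENNReal.ofReal_toReal hys).symm⟩
  obtain ⟨L, hL0, rfl⟩ : ∃ r : ℝ, 0 ≤ r ∧ Lo = ENNReal.ofReal r :=
    ⟨_, ENNReal.toReal_nonneg, (ENNReal.ofReal_toReal hLo).symm⟩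
  obtain ⟨S2, hS20, rfl⟩ : ∃ r : ℝ, 0 ≤ r ∧ S₂ = ENNReal.ofReal r :=
    ⟨_, ENNReal.toReal_nonneg, (ENNReal.ofReal_toReal hS₂f).symm⟩
  obtain ⟨S3, hS30, rfl⟩ : ∃ r : ℝ, 0 ≤ r ∧ S₃ = ENNReal.ofReal r :=
    ⟨_, ENNReal.toReal_nonneg, (ENNReal.ofReal_toReal hS₃f).symm⟩
  obtain ⟨Yr, hYr0, rfl⟩ : ∃ r : ℝ, 0 ≤ r ∧ Y = ENNReal.ofReal r :=
    ⟨_, ENNReal.toReal_nonneg, (ENNReal.ofReal_toReal hY).symm⟩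
  -- the four inequalities in `ℝ`
  have h1 : κ * y ≤ L + p * S2 * S3 + κ * q + κ * L := by
    refine (ENNReal.ofReal_le_ofReal_iff (by positivity)).1 ?_
    rw [ENNReal.ofReal_add (by positivity) (by positivity),
      ENNReal.ofReal_add (by positivity) (by positivity),
      ENNReal.ofReal_add (by positivity) (by positivity),
      ENNReal.ofReal_mul (q := y) hκ.le, ENNReal.ofReal_mul (q := L) hκ.le,
      ENNReal.ofReal_mul (q := S3) (mul_nonneg hp hS20), ENNReal.ofReal_mul (q := S2) hp]
    exact hstar
  have h2 : S2 ≤ M := (ENNReal.ofReal_le_ofReal_iff hM).1 hS₂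
  have h3 : S3 ≤ l / 2 * Yr + 1 / (2 * l) * M := by
    refine (ENNReal.ofReal_le_ofReal_iff (by positivity)).1 ?_
    rw [ENNReal.ofReal_add (by positivity) (by positivity),
      ENNReal.ofReal_mul (q := Yr) (by positivity), ENNReal.ofReal_mul (q := M) (by positivity)]
    exact hS₃
  have h4 : Yr ≤ y + D + η * Yr := by
    refine (ENNReal.ofReal_le_ofReal_iff (by positivity)).1 ?_
    rw [ENNReal.ofReal_add (by positivity) (by positivity), ENNReal.ofReal_add hy0 hD,
      ENNReal.ofReal_mul (q := Yr) hη0]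
    exact hYb
  have key := lossFloorGlue_div hκ
    (lossFloorGlue_real hy0 hS30 hYr0 hκ.le hp hM hη hpl h1 h2 h3 h4)
  -- back to `ℝ≥0∞`
  have hc0 : 0 ≤ κ / 2 / (1 + κ) := by positivity
  rw [← ENNReal.ofReal_mul hc0, ← ENNReal.ofReal_add (by positivity) hL0]
  exact ENNReal.ofReal_le_ofReal key
/-- **The window assembly** (abstract form of the stub, over one window `[s, s + h]`, `h = x₃⁻¹`).
For contents `y, m₂, m₃ ≥ 0`, window gain/loss `G r = Gain(s,r]`, `L r = Loss(s,r]` and the integrated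
fast fifth moment `I`: the ledger `y r + L r = y s + G r`, the gain ceiling
`G r ≤ D + η sup_{[s,r]} y` (`η ≤ 1/2`), the crude bound `y ≤ B′`, the datum bound `y 0 ≤ B`, the
moment bounds `m₂ ≤ 1 + y 0`, `m₃ ≤ (l/2) y + m₂/(2l)`, WF and LIF at the window give
`c · y s ≤ c · A + L (s + h)` with the explicit `c = (κ₀/2)/(1+κ₀)`, `κ₀ = δσ²K₀`, and `A`. [folklore] -/
theorem lossFloorGlue_window {y m₂ m₃ G L : ℝ → ℝ≥0∞} {I : ℝ≥0∞}
    {s h x3 δ σ K₀ C B B' D η l : ℝ}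
    (hx3 : 0 < x3) (hx3h : x3 * h = 1) (hδ : 0 < δ) (hσ : 0 < σ) (hK₀ : 1 ≤ K₀)
    (hC : 0 ≤ C) (hB : 0 ≤ B) (hD : 0 ≤ D) (hη0 : 0 ≤ η) (hη : η ≤ 1 / 2) (hl : 0 < l)
    (hlκ : C * σ ^ 2 * (1 + B) * l ≤ δ * σ ^ 2 * K₀ / 4)
    (hbdd : ∀ r, y r ≤ ENNReal.ofReal B') (hy0 : y 0 ≤ ENNReal.ofReal B)
    (hm₂ : ∀ r, m₂ r ≤ 1 + y 0)
    (hm₃ : ∀ r, m₃ r ≤ ENNReal.ofReal (l / 2) * y r + ENNReal.ofReal (1 / (2 * l)) * m₂ r)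
    (hled : ∀ r ∈ Icc s (s + 1 * h), y r + L r = y s + G r)
    (hgain : ∀ r ∈ Icc s (s + 1 * h),
      G r ≤ ENNReal.ofReal D + ENNReal.ofReal η * ⨆ r' ∈ Icc s r, y r')
    (hWF : ENNReal.ofReal ((s + 1 * h - s) * K₀) * y s ≤
      I + ENNReal.ofReal ((s + 1 * h - s) * K₀ ^ 5) +
        ENNReal.ofReal ((s + 1 * h - s) * K₀) * L (s + 1 * h))
    (hLIF : ENNReal.ofReal (δ * (σ ^ 2 * x3)) * I ≤
      L (s + 1 * h) + ENNReal.ofReal (C * (σ ^ 2 * x3 * (s + 1 * h - s))) *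
        (⨆ r ∈ Icc s (s + 1 * h), m₂ r) * (⨆ r ∈ Icc s (s + 1 * h), m₃ r)) :
    ENNReal.ofReal (δ * σ ^ 2 * K₀ / 2 / (1 + δ * σ ^ 2 * K₀)) * y s ≤
      ENNReal.ofReal (δ * σ ^ 2 * K₀ / 2 / (1 + δ * σ ^ 2 * K₀) *
          ((δ * σ ^ 2 * K₀ * K₀ ^ 4 + δ * σ ^ 2 * K₀ / 4 * D +
              C * σ ^ 2 * (1 + B) * (1 / (2 * l) * (1 + B))) / (δ * σ ^ 2 * K₀ / 2))) +
        L (s + 1 * h) := by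
  have hss : s + 1 * h - s = h := by ring
  rw [hss] at hWF hLIF
  have hp : C * (σ ^ 2 * x3 * h) = C * σ ^ 2 := by linear_combination (C * σ ^ 2) * hx3h
  rw [hp] at hLIF
  have hK : 0 < K₀ := by linarith
  -- the second moments
  have hM2 : ∀ r, m₂ r ≤ ENNReal.ofReal (1 + B) := fun r => by
    rw [ENNReal.ofReal_add zero_le_one hB, ENNReal.ofReal_one]
    exact (hm₂ r).trans (add_le_add le_rfl hy0)
  have hS₂ : (⨆ r ∈ Icc s (s + 1 * h), m₂ r) ≤ ENNReal.ofReal (1 + B) :=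
    iSup₂_le fun r _ => hM2 r
  -- the third moments against the window supremum `Y` of the quartic content
  set Y : ℝ≥0∞ := ⨆ r ∈ Icc s (s + 1 * h), y r with hY_def
  have hyY : ∀ r ∈ Icc s (s + 1 * h), y r ≤ Y := fun r hr =>
    le_iSup₂ (f := fun r (_ : r ∈ Icc s (s + 1 * h)) => y r) r hr
  have hS₃ : (⨆ r ∈ Icc s (s + 1 * h), m₃ r) ≤
      ENNReal.ofReal (l / 2) * Y + ENNReal.ofReal (1 / (2 * l)) * ENNReal.ofReal (1 + B) :=
    iSup₂_le fun r hr => (hm₃ r).trans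
      (add_le_add (mul_le_mul' le_rfl (hyY r hr)) (mul_le_mul' le_rfl (hM2 r)))
  -- the window supremum against the window start (ledger + gain ceiling on sub-windows)
  have hYb : Y ≤ y s + ENNReal.ofReal D + ENNReal.ofReal η * Y := by
    refine iSup₂_le fun r hr => ?_
    calc y r ≤ y r + L r := le_self_add
      _ = y s + G r := hled r hr
      _ ≤ y s + (ENNReal.ofReal D + ENNReal.ofReal η * ⨆ r' ∈ Icc s r, y r') :=
          add_le_add le_rfl (hgain r hr)
      _ ≤ y s + (ENNReal.ofReal D + ENNReal.ofReal η * Y) := by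
          gcongr
          exact biSup_mono fun r' hr' => ⟨hr'.1, hr'.2.trans hr.2⟩
      _ = y s + ENNReal.ofReal D + ENNReal.ofReal η * Y := (add_assoc _ _ _).symm
  -- finiteness
  have hys : y s ≠ ⊤ := ne_top_of_le_ne_top ENNReal.ofReal_ne_top (hbdd s)
  have hYf : Y ≠ ⊤ := ne_top_of_le_ne_top ENNReal.ofReal_ne_top (iSup₂_le fun r _ => hbdd r)
  -- the clock cancels: `ν h = σ²`
  have hka : δ * (σ ^ 2 * x3) * (h * K₀) = δ * σ ^ 2 * K₀ := by
    linear_combination (δ * σ ^ 2 * K₀) * hx3h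
  have hkb : δ * (σ ^ 2 * x3) * (h * K₀ ^ 5) = δ * σ ^ 2 * K₀ * K₀ ^ 4 := by
    linear_combination (δ * σ ^ 2 * K₀ ^ 5) * hx3h
  exact lossFloorGlue_ennreal (by positivity) (by positivity) (by positivity) (by positivity)
    (by positivity) hl hD hη0 hη hlκ hka hkb hys hYf hWF hLIF hS₂ hS₃ hYb
/-- **Stub S1-glue — THE LOSS FLOOR FROM THE LOSS-INTENSITY FLOOR** (glue) of the line
`quartic-schur-ledger` (crux stmt-AtomisticToContinuum-9235, `EnergyCurrentTails`):
`S2 → Q0 → LIF → WF → S1`.  Assuming the sub-linear window gain ceiling S2, the quartic datum bound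
Q0, the loss-intensity floor LIF (`δ ν_N ∫_s^{s′} M₅^{>K₀} ≤ Loss(s,s′] + C ν_N (s′−s) sup m₂ sup m₃`
on every horizon) and the window quartic floor WF
(`(s′−s)K₀ y(s) ≤ ∫_s^{s′} M₅^{>K₀} + (s′−s)K₀⁵ + (s′−s)K₀ Loss(s,s′]`), the window loss floor S1
holds in the frame of the crux: for `t < T` there are `τ = 1`, `c ∈ (0,1]`, `A ≥ 0`, `N₀` with
`c · y_N(s) ≤ c · A + Loss_N(s, s + (N+1)^{-1/3}]` for `N ≥ N₀`, `s ∈ [0,t]`.  Constants: horizon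
`t + 2` in LIF, `κ₀ = δσ²K₀`, slope `η = 1/2` in S2, `l = κ₀/(4(Cσ²(1+B)+1))`,
`c = (κ₀/2)/(1+κ₀)`; the window bookkeeping is `lossFloorGlue_window` (ledger
`stub_quarticLedger`, `lintegral_normSqAvg_le`, `lintegral_cubicAvg_le`, probability of `λ_N` for
`σ ≤ 1/2`). [folklore] -/
theorem stub_lossFloor_of_lossIntensityFloor :
    (∀ (a₀ θ₀ : T3 → ℝ) (u₀ : T3 → V3), Continuous a₀ → Continuous θ₀ → Continuous u₀ →
        (∀ x, 0 < a₀ x) → (∀ x, 0 < θ₀ x) →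
        ∃ σ₀ : ℝ, 0 < σ₀ ∧ ∀ σ : ℝ, 0 < σ → σ < σ₀ →
          ∀ (T : ℝ) (ρ θ : ℝ → T3 → ℝ) (u : ℝ → T3 → V3), IsHardSphereEulerSolution σ T ρ u θ →
            ∀ Φ : (N : ℕ) → HardSphereFlow (Torus.geometry (Fin 3)) (hsDiameter σ N) (N + 1),
              TendstoHydroFieldsAt (fun N => localGibbsLaw σ a₀ u₀ θ₀ N (Φ N)) Φ ρ u θ 0 →
                ∀ t ∈ Set.Ico 0 T, ∀ τ : ℝ, 0 < τ → ∀ η : ℝ, 0 < η → ∃ D : ℝ, 0 ≤ D ∧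
                  ∃ N₀ : ℕ, ∀ N : ℕ, N₀ ≤ N → ∀ s ∈ Set.Icc 0 t,
                    ∀ s' ∈ Set.Icc s (s + τ * ((N : ℝ) + 1) ^ (-(1 / 3 : ℝ))),
                      (∫⁻ z, ENNReal.ofReal (((N : ℝ) + 1)⁻¹ *
                          (Φ N).collisionSum (Set.Ioc s s')
                            (fun col => max (‖col.postVel.1‖ ^ 4 + ‖col.postVel.2‖ ^ 4
                              - ‖col.preVel.1‖ ^ 4 - ‖col.preVel.2‖ ^ 4) 0 / 2) z)
                        ∂(localGibbsLaw σ a₀ u₀ θ₀ N (Φ N)))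
                      ≤ ENNReal.ofReal D + ENNReal.ofReal η *
                          ⨆ r ∈ Set.Icc s s',
                            (∫⁻ z, ENNReal.ofReal (((N : ℝ) + 1)⁻¹ *
                                ∑ i : Fin (N + 1), ‖((Φ N).flow r z i).2‖ ^ 4)
                              ∂(localGibbsLaw σ a₀ u₀ θ₀ N (Φ N)))) →
      (∀ (a₀ θ₀ : T3 → ℝ) (u₀ : T3 → V3), Continuous a₀ → Continuous θ₀ → Continuous u₀ →
        (∀ x, 0 < a₀ x) → (∀ x, 0 < θ₀ x) →
        ∃ σ₀ : ℝ, 0 < σ₀ ∧ ∀ σ : ℝ, 0 < σ → σ < σ₀ → ∀ T : ℝ, 0 < T →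
          ∀ Φ : ((N : ℕ) → HardSphereFlow (Torus.geometry (Fin 3)) (hsDiameter σ N) (N + 1)),
            ∃ δ : ℝ, 0 < δ ∧ ∃ K₀ : ℝ, 1 ≤ K₀ ∧ ∃ C : ℝ, 0 ≤ C ∧ ∃ N₀ : ℕ, ∀ N : ℕ, N₀ ≤ N →
              ∀ s s' : ℝ, 0 ≤ s → s ≤ s' → s' ≤ T →
                ENNReal.ofReal (δ * (σ ^ 2 * ((N : ℝ) + 1) ^ (1 / 3 : ℝ))) *
                    (∫⁻ r in Set.Ioc s s',
                      (∫⁻ z, ENNReal.ofReal (((N : ℝ) + 1)⁻¹ *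
                          ∑ i : Fin (N + 1), (if K₀ < ‖((Φ N).flow r z i).2‖ then
                            ‖((Φ N).flow r z i).2‖ ^ 5 else 0))
                        ∂(localGibbsLaw σ a₀ u₀ θ₀ N (Φ N))))
                  ≤ (∫⁻ z, ENNReal.ofReal (((N : ℝ) + 1)⁻¹ *
                        (Φ N).collisionSum (Set.Ioc s s')
                          (fun col => max (‖col.preVel.1‖ ^ 4 + ‖col.preVel.2‖ ^ 4
                            - ‖col.postVel.1‖ ^ 4 - ‖col.postVel.2‖ ^ 4) 0 / 2) z)
                      ∂(localGibbsLaw σ a₀ u₀ θ₀ N (Φ N))) +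
                    ENNReal.ofReal (C * (σ ^ 2 * ((N : ℝ) + 1) ^ (1 / 3 : ℝ) * (s' - s))) *
                      (⨆ r ∈ Set.Icc s s',
                        (∫⁻ z, ENNReal.ofReal (((N : ℝ) + 1)⁻¹ *
                            ∑ i : Fin (N + 1), ‖((Φ N).flow r z i).2‖ ^ 2)
                          ∂(localGibbsLaw σ a₀ u₀ θ₀ N (Φ N)))) *
                      (⨆ r ∈ Set.Icc s s',
                        (∫⁻ z, ENNReal.ofReal (((N : ℝ) + 1)⁻¹ *
                            ∑ i : Fin (N + 1), ‖((Φ N).flow r z i).2‖ ^ 3)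
                          ∂(localGibbsLaw σ a₀ u₀ θ₀ N (Φ N))))) →
    (∀ (a₀ θ₀ : T3 → ℝ) (u₀ : T3 → V3), Continuous a₀ → Continuous θ₀ → Continuous u₀ →
        (∀ x, 0 < a₀ x) → (∀ x, 0 < θ₀ x) →
        ∃ σ₀ : ℝ, 0 < σ₀ ∧ ∀ σ : ℝ, 0 < σ → σ < σ₀ →
          ∀ (T : ℝ) (ρ θ : ℝ → T3 → ℝ) (u : ℝ → T3 → V3), IsHardSphereEulerSolution σ T ρ u θ →
            ∀ Φ : (N : ℕ) → HardSphereFlow (Torus.geometry (Fin 3)) (hsDiameter σ N) (N + 1),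
              TendstoHydroFieldsAt (fun N => localGibbsLaw σ a₀ u₀ θ₀ N (Φ N)) Φ ρ u θ 0 →
                ∀ t ∈ Set.Ico 0 T, ∃ τ : ℝ, 0 < τ ∧ ∃ c : ℝ, 0 < c ∧ c ≤ 1 ∧ ∃ A : ℝ, 0 ≤ A ∧
                  ∃ N₀ : ℕ, ∀ N : ℕ, N₀ ≤ N → ∀ s ∈ Set.Icc 0 t,
                    ENNReal.ofReal c *
                        (∫⁻ z, ENNReal.ofReal (((N : ℝ) + 1)⁻¹ *
                            ∑ i : Fin (N + 1), ‖((Φ N).flow s z i).2‖ ^ 4)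
                          ∂(localGibbsLaw σ a₀ u₀ θ₀ N (Φ N)))
                      ≤ ENNReal.ofReal (c * A) +
                        (∫⁻ z, ENNReal.ofReal (((N : ℝ) + 1)⁻¹ *
                            (Φ N).collisionSum (Set.Ioc s (s + τ * ((N : ℝ) + 1) ^ (-(1 / 3 : ℝ))))
                              (fun col => max (‖col.preVel.1‖ ^ 4 + ‖col.preVel.2‖ ^ 4
                                - ‖col.postVel.1‖ ^ 4 - ‖col.postVel.2‖ ^ 4) 0 / 2) z)
                          ∂(localGibbsLaw σ a₀ u₀ θ₀ N (Φ N)))) := by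
  intro hS2 hLIF a₀ θ₀ u₀ ha hθ hu ha0 hθ0
  have hQ0 := stub_quarticData
  have hWF := stub_windowQuarticFloor
  obtain ⟨σ₁, hσ₁, H1⟩ := hS2 a₀ θ₀ u₀ ha hθ hu ha0 hθ0
  obtain ⟨σ₂, hσ₂, H2⟩ := hQ0 a₀ θ₀ u₀ ha hθ hu ha0 hθ0
  obtain ⟨σ₃, hσ₃, H3⟩ := hLIF a₀ θ₀ u₀ ha hθ hu ha0 hθ0
  have HW := hWF a₀ θ₀ u₀ ha hθ hu ha0 hθ0
  clear hS2 hQ0 hLIF hWF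
  refine ⟨min (min σ₁ (min σ₂ σ₃)) (1 / 2), by positivity, ?_⟩
  intro σ hσ hσ0 T ρ θ u hE Φ h0 t ht
  have hσ₁' : σ < σ₁ := hσ0.trans_le ((min_le_left _ _).trans (min_le_left _ _))
  have hσ₂' : σ < σ₂ :=
    hσ0.trans_le ((min_le_left _ _).trans ((min_le_right _ _).trans (min_le_left _ _)))
  have hσ₃' : σ < σ₃ :=
    hσ0.trans_le ((min_le_left _ _).trans ((min_le_right _ _).trans (min_le_right _ _)))
  have hσh : σ < 1 / 2 := hσ0.trans_le (min_le_right _ _)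
  -- the constants: LIF on the horizon `t + 2`, Q0, S2 at `τ = 1`, `η = 1/2`
  have hT' : 0 < t + 2 := by linarith [ht.1]
  obtain ⟨δ, hδ, K₀, hK₀, C, hC, N₁, HL⟩ := H3 σ hσ hσ₃' (t + 2) hT' Φ
  obtain ⟨B, hB, N₂, HQ⟩ := H2 σ hσ hσ₂' Φ
  obtain ⟨D, hD, N₃, HS⟩ := H1 σ hσ hσ₁' T ρ θ u hE Φ h0 t ht 1 one_pos (1 / 2) (by norm_num)
  have hK : 0 < K₀ := by linarith
  have hκ : 0 < δ * σ ^ 2 * K₀ := by positivity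
  have hP : 0 < C * σ ^ 2 * (1 + B) + 1 := by positivity
  obtain ⟨l, hl_def⟩ : ∃ l : ℝ, l = δ * σ ^ 2 * K₀ / (4 * (C * σ ^ 2 * (1 + B) + 1)) := ⟨_, rfl⟩
  have hl : 0 < l := by
    rw [hl_def]
    positivity
  have hlκ : C * σ ^ 2 * (1 + B) * l ≤ δ * σ ^ 2 * K₀ / 4 := by
    rw [hl_def, mul_div_assoc', div_le_div_iff₀ (by positivity) (by norm_num)]
    nlinarith [hκ.le, hP.le]
  refine ⟨1, one_pos, δ * σ ^ 2 * K₀ / 2 / (1 + δ * σ ^ 2 * K₀), by positivity,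
    (div_le_one (by positivity)).2 (by linarith),
    (δ * σ ^ 2 * K₀ * K₀ ^ 4 + δ * σ ^ 2 * K₀ / 4 * D +
        C * σ ^ 2 * (1 + B) * (1 / (2 * l) * (1 + B))) / (δ * σ ^ 2 * K₀ / 2),
    by positivity, max N₁ (max N₂ N₃), fun N hN s hs => ?_⟩
  have hN₁ : N₁ ≤ N := (le_max_left _ _).trans hN
  have hN₂ : N₂ ≤ N := ((le_max_left _ _).trans (le_max_right _ _)).trans hN
  have hN₃ : N₃ ≤ N := ((le_max_right _ _).trans (le_max_right _ _)).trans hN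
  obtain ⟨hQ4, B', hB'⟩ := HQ N hN₂
  haveI := isProbabilityMeasure_localGibbsLaw ha hθ hu ha0 hθ0 hσh.le N (Φ N)
  have hgood := ae_mem_good_localGibbsLaw σ a₀ u₀ θ₀ N (Φ N)
  -- the window `h = (N+1)^{-1/3}`
  have hx : (0 : ℝ) < (N : ℝ) + 1 := by positivity
  have hx1 : (1 : ℝ) ≤ (N : ℝ) + 1 := le_add_of_nonneg_left (Nat.cast_nonneg N)
  have hh : 0 < ((N : ℝ) + 1) ^ (-(1 / 3 : ℝ)) := Real.rpow_pos_of_pos hx _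
  have hx3 : 0 < ((N : ℝ) + 1) ^ (1 / 3 : ℝ) := Real.rpow_pos_of_pos hx _
  have hx3h : ((N : ℝ) + 1) ^ (1 / 3 : ℝ) * ((N : ℝ) + 1) ^ (-(1 / 3 : ℝ)) = 1 := by
    rw [Real.rpow_neg hx.le, mul_inv_cancel₀ hx3.ne']
  have hh1 : ((N : ℝ) + 1) ^ (-(1 / 3 : ℝ)) ≤ 1 :=
    Real.rpow_le_one_of_one_le_of_nonpos hx1 (by norm_num)
  have hs0 : 0 ≤ s := hs.1
  have hss' : s ≤ s + 1 * ((N : ℝ) + 1) ^ (-(1 / 3 : ℝ)) := by linarith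
  have hs'T : s + 1 * ((N : ℝ) + 1) ^ (-(1 / 3 : ℝ)) ≤ t + 2 := by linarith [hs.2]
  exact lossFloorGlue_window
    (y := fun r => ∫⁻ z, ENNReal.ofReal (((N : ℝ) + 1)⁻¹ *
        ∑ i : Fin (N + 1), ‖((Φ N).flow r z i).2‖ ^ 4) ∂(localGibbsLaw σ a₀ u₀ θ₀ N (Φ N)))
    (m₂ := fun r => ∫⁻ z, ENNReal.ofReal (((N : ℝ) + 1)⁻¹ *
        ∑ i : Fin (N + 1), ‖((Φ N).flow r z i).2‖ ^ 2) ∂(localGibbsLaw σ a₀ u₀ θ₀ N (Φ N)))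
    (m₃ := fun r => ∫⁻ z, ENNReal.ofReal (((N : ℝ) + 1)⁻¹ *
        ∑ i : Fin (N + 1), ‖((Φ N).flow r z i).2‖ ^ 3) ∂(localGibbsLaw σ a₀ u₀ θ₀ N (Φ N)))
    (G := fun r => ∫⁻ z, ENNReal.ofReal (((N : ℝ) + 1)⁻¹ *
        (Φ N).collisionSum (Set.Ioc s r)
          (fun col => max (‖col.postVel.1‖ ^ 4 + ‖col.postVel.2‖ ^ 4
            - ‖col.preVel.1‖ ^ 4 - ‖col.preVel.2‖ ^ 4) 0 / 2) z)
      ∂(localGibbsLaw σ a₀ u₀ θ₀ N (Φ N)))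
    (L := fun r => ∫⁻ z, ENNReal.ofReal (((N : ℝ) + 1)⁻¹ *
        (Φ N).collisionSum (Set.Ioc s r)
          (fun col => max (‖col.preVel.1‖ ^ 4 + ‖col.preVel.2‖ ^ 4
            - ‖col.postVel.1‖ ^ 4 - ‖col.postVel.2‖ ^ 4) 0 / 2) z)
      ∂(localGibbsLaw σ a₀ u₀ θ₀ N (Φ N)))
    hx3 hx3h hδ hσ hK₀ hC hB hD (by norm_num) le_rfl hl hlκ hB' hQ4
    (fun r => lintegral_normSqAvg_le (Φ N) _ hgood r)
    (fun r => lintegral_cubicAvg_le (Φ N) _ r hl)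
    (fun r hr => stub_quarticLedger a₀ θ₀ u₀ σ hσ hσh N (Φ N) s r hs0 hr.1)
    (HS N hN₃ s hs)
    (HW σ hσ hσh N (Φ N) K₀ hK.le s _ hs0 hss')
    (HL N hN₁ s _ hs0 hss' hs'T)

end Summit.AtomisticToContinuum.HydrodynamicLimit.Theorems.QuarticSchurLedger

end
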